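import Summits.CriticalPhenomena.PercolationContinuityZ3.Theorems.PercNearOneGluingNoHeavyLowerTailSahiCoSingletonFubini
import Mathlib.Tactic.Linarith
import Mathlib.Tactic.Ring
import HarnessLib

/-!
# `NoHeavyLowerTail` (stmt-CriticalPhenomena-4575) — the co-singleton bound with a TRIVIAL slot: `(f, g, 1)`

Support file, seat `prim-l12-p5` (gen 2), `--supports stmt-CriticalPhenomena-4575`.  No definitions, no named facts, no sorries.

For a triple with one identically-`1` slot, `E₃(f,g,1) = E₂(f,g) = Cov(f,g)` and the joint pivotality of a coordinate `j` reduces to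
`J_j = Σ_v w(v)·π_f(v)π_g(v)` (the constant slot is never pivotal and always `= 1`).  By the `E₂` row (`coinfluence_le_sahiE_two`)
the UN-halved co-singleton bound holds for EVERY `j`:

* `coSingletonSum_le_sahiE_of_const_one` : `coSingletonSum q ![f, g, 1] j ≤ E₃(f,g,1)` — so on this class CoS holds at every coordinate
  and HC holds with a factor `2` to spare.
-/

namespace Summit.CriticalPhenomena.PercolationContinuityZ3.Theorems

namespace SahiCoSingleton

open Finset Literature.Combinatorics.Sahi2008 SahiSubsetChord

variable {ι : Type*} [Fintype ι] [DecidableEq ι]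

/-- **Co-singleton bound with a trivial slot.**  For monotone `{0,1}`-valued `f, g`, the constant function `1`, every product weight and
every coordinate `j`: `E[E₃ of the one-coin sections of (f,g,1) at j] ≤ E₃(f,g,1)` (`= Cov(f,g)`). [this file] -/
theorem coSingletonSum_le_sahiE_of_const_one (q : ι → ℝ) (hq : ∀ i, 0 ≤ q i ∧ q i ≤ 1) (f g : (ι → Bool) → ℝ)
    (hf01 : ∀ x, f x = 0 ∨ f x = 1) (hg01 : ∀ x, g x = 0 ∨ g x = 1) (hfm : Monotone f) (hgm : Monotone g) (j : ι) :
    coSingletonSum q ![f, g, fun _ => 1] j ≤ sahiE (prodWeight q) 3 ![f, g, fun _ => 1] := by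
  have hind : ∀ a x, (![f, g, fun _ => 1] : Fin 3 → (ι → Bool) → ℝ) a x = 0 ∨
      (![f, g, fun _ => 1] : Fin 3 → (ι → Bool) → ℝ) a x = 1 := by
    intro a x; fin_cases a
    · exact hf01 x
    · exact hg01 x
    · exact Or.inr rfl
  have hmono : ∀ a, Monotone ((![f, g, fun _ => 1] : Fin 3 → (ι → Bool) → ℝ) a) := by
    intro a; fin_cases a
    · exact hfm
    · exact hgm
    · exact fun _ _ _ => le_rfl
  have hf0 : ∀ x, 0 ≤ f x := fun x => by rcases hf01 x with e | e <;> simp [e]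
  have hg0 : ∀ x, 0 ≤ g x := fun x => by rcases hg01 x with e | e <;> simp [e]
  set s := q j with hs
  set w : ({i // i ∈ (univ : Finset ι).erase j} → Bool) → ℝ :=
    prodWeight (fun i : {i // i ∈ (univ : Finset ι).erase j} => q i) with hw
  -- E₃(f,g,1) = E(fg) − Ef·Eg = E₂(f,g)
  have hsum : ∑ x, prodWeight q x = 1 := sum_coinWeight q
  have hE3 : sahiE (prodWeight q) 3 ![f, g, fun _ => 1] = sahiE (prodWeight q) 2 ![f, g] := by
    rw [sahiE_three_apply, sahiE_two]
    have e1 : ex (prodWeight q) ((![f, g, fun _ => (1:ℝ)] : Fin 3 → (ι → Bool) → ℝ) 2) = 1 := ex_const hsum 1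
    simp only [Matrix.cons_val_zero, Matrix.cons_val_one, Matrix.head_cons, Matrix.cons_val_two, Matrix.tail_cons] at e1 ⊢
    have e2 : f * g * (fun _ : ι → Bool => (1:ℝ)) = f * g := by funext x; simp
    have e3 : f * (fun _ : ι → Bool => (1:ℝ)) = f := by funext x; simp
    have e4 : g * (fun _ : ι → Bool => (1:ℝ)) = g := by funext x; simp
    rw [e2, e3, e4, e1]
    ring
  -- the co-singleton sum: J-integrand = π_f π_g
  rw [coSingletonSum_eq q _ hind hmono j, hE3]
  have hJ : jointPivotality q ![f, g, fun _ => 1] j = ∑ v, w v * ((f (hi j v) - f (lo j v)) * (g (hi j v) - g (lo j v))) := by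
    unfold jointPivotality
    refine Finset.sum_congr rfl fun v _ => ?_
    simp only [Matrix.cons_val_zero, Matrix.cons_val_one, Matrix.head_cons, Matrix.cons_val_two, Matrix.tail_cons]
    ring
  rw [hJ]
  exact coinfluence_le_sahiE_two q hq f g hf0 hg0 hfm hgm j

end SahiCoSingleton

end Summit.CriticalPhenomena.PercolationContinuityZ3.Theorems
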